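import Summits.Schanuel.Schanuel.Theorems.RootDecomp1EScaleTransfer01

/-!
# RootDecomp1EScaleTransfer — lens 2, generation 35 «SCALE-TRANSFER CELL» (ScaleTransfer.lean bf37e395…, 1670 l) — continuation (RootDecomp1EScaleTransfer02): §3 the cut predicate `HyperScaleApprox` and the TRANSFER KERNEL `algebraicIndependent_exp_scale` (mod `hLW`), `yFree_necessary`

(lens-2 g35 `ScaleTransfer.lean`, sha256 bf37e395…8f98, own farm rc 0 · 0 sorry · axioms std; critic VERDICT STATUS L1636 (d) PORT GO LOW;
port by census-1 gen 15 in five parts `RootDecomp1EScaleTransfer01`–`05` — see the PORT NOTE of part 01; `--supports stmt-Schanuel-31409`; rung 0.)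
-/

noncomputable section

open Complex IntermediateField
open Summit.Schanuel.Schanuel.Theorems.RootDecomp1KHyper (LWMeasure SB SFset mvlen mvlen_nonneg
  abs_coeff_le_mvlen one_le_mvlen exists_int_mul_eq_map mvaeval_int_map sb_of_algebraicIndependent
  mem_adjoin_SFset_I' form_ne_zero_of_linearIndependent)

namespace Summit.Schanuel.Schanuel.Theorems.RootDecomp1EScaleTransfer

variable {D n : ℕ}

/-! ## §3 The cut predicate and the TRANSFER KERNEL -/

/-- **`HyperScaleApprox ω y ξ`** — the SCALE `ξ` is hyper-approximable through the order lattice of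
`ω`: for every `m` there are `γ ≠ 0` and an integer matrix `M` with `γ · y_j = Σ_i M_ij ω_i` for
ALL `j` (the whole tuple `γ y` lies in the ℤ-span of `ω`) and `‖ξ − γ‖ < exp(−exp(s^m))`,
`s = 2 + Σ_{i,j} |M_ij|` (a doubly-exponential = «hyper» rate in the size of the lattice data). -/
def HyperScaleApprox {D n : ℕ} (ω : Fin D → ℂ) (y : Fin n → ℂ) (ξ : ℂ) : Prop :=
  ∀ m : ℕ, ∃ (γ : ℂ) (M : Fin D → Fin n → ℤ), γ ≠ 0 ∧ (∀ j, γ * y j = ∑ i, (M i j : ℂ) * ω i) ∧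
    ‖ξ - γ‖ < Real.exp (-Real.exp ((2 + (msize M : ℝ)) ^ m))

/-- `exp(−x) ≤ 1/x` for `x > 0`. -/
private theorem exp_neg_le_one_div {x : ℝ} (hx : 0 < x) : Real.exp (-x) ≤ 1 / x := by
  rw [Real.exp_neg, ← one_div]
  exact one_div_le_one_div_of_le hx (by linarith [Real.add_one_le_exp x])

/-- `x ≤ exp x`. -/
private theorem self_le_exp (x : ℝ) : x ≤ Real.exp x := by linarith [Real.add_one_le_exp x]

set_option maxHeartbeats 1600000 in
/-- **TRANSFER KERNEL.** `P(e^{ξ y₁}, …, e^{ξ yₙ}) ≠ 0` for every non-zero `P ∈ ℤ[X₁, …, Xₙ]`, when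
`y` is ℚ-free and the scale `ξ` is hyper-approximable through the order lattice of an algebraic ℚ-free
`ω` (mod `hLW`, Ably's Lindemann–Weierstrass measure for `e^{ω}`, tree-proved).  At an approximant
`γ` the point `e^{γ y}` is a monomial point `∏_i E_i^{M_ij}` of the FIXED measured tuple `E = e^{ω}`;
the substituted polynomial `A = (∏ E)^N · P(X^M)` is non-zero (column-freeness), of the same height and
of degree `O(s)`, so `|A(E)| ≥ exp(−exp(O(s^{D+1})))` by the measure, while
`|A(E)| = |e^{NΣω}| · |P(e^{γy}) − P(e^{ξy})| ≤ e^{O(s)} · K · exp(−exp(s^m))`. -/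
theorem expPoly_ne_zero_of_hyperScaleApprox (hLW : LWMeasure) {ω : Fin D → ℂ}
    (hωalg : ∀ i, IsAlgebraic ℚ (ω i)) (hω : LinearIndependent ℚ ω) {y : Fin n → ℂ}
    (hy : LinearIndependent ℚ y) {ξ : ℂ} (hξ : HyperScaleApprox ω y ξ)
    {P : MvPolynomial (Fin n) ℤ} (hP : P ≠ 0) : expPoly y P ξ ≠ 0 := by
  intro hroot
  -- fixed data: the measure, the Lipschitz constant, degree and height of P
  obtain ⟨C, c₂, hC, hc₂, hmeas⟩ := hLW D ω hωalg hω
  obtain ⟨K, δ, hK, hδ, hLip⟩ := exists_lipschitz_expPoly y P ξ hroot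
  set d : ℕ := P.totalDegree with hd
  set H : ℕ := (mvlen P).toNat with hH
  have hHZ : (H : ℤ) = mvlen P := by rw [hH, Int.toNat_of_nonneg (mvlen_nonneg P)]
  have hH1 : (1 : ℝ) ≤ H := by
    have : (1 : ℤ) ≤ H := by rw [hHZ]; exact one_le_mvlen hP
    exact_mod_cast this
  have hHpos : (0 : ℝ) < H := by linarith
  have hcoeffP : ∀ a, |P.coeff a| ≤ (H : ℤ) := fun a => by rw [hHZ]; exact abs_coeff_le_mvlen P a
  set w : ℝ := ‖∑ i, ω i‖ with hw
  have hw0 : 0 ≤ w := norm_nonneg _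
  have hK0 : 0 ≤ K := by linarith
  -- the constants and the choice of m
  set G : ℝ := K + w + c₂ * H + c₂ with hG
  have hG0 : 0 ≤ G := by positivity
  set q : ℕ := 2 * D * d + d + 1 with hq
  set c₆ : ℝ := (G + C) * (q : ℝ) ^ (D + 1) with hc₆
  have hc₆0 : 0 ≤ c₆ := by positivity
  have hδinv : 0 < δ⁻¹ := inv_pos.mpr hδ
  obtain ⟨m₀, hm₀⟩ := Summit.Schanuel.Schanuel.Theorems.RootDecomp1KHyper.exists_le_two_pow (c₆ + δ⁻¹ + 1)
  set m : ℕ := m₀ + (D + 1) with hm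
  -- the approximant
  obtain ⟨γ, M, hγ0, hγ, hdist⟩ := hξ m
  set S : ℕ := msize M with hS
  set s : ℝ := 2 + (S : ℝ) with hs
  have hS0 : (0 : ℝ) ≤ S := Nat.cast_nonneg _
  have hs2 : (2 : ℝ) ≤ s := by rw [hs]; linarith
  have hs1 : (1 : ℝ) ≤ s := by linarith
  have hs0 : (0 : ℝ) < s := by linarith
  have hSs : (S : ℝ) ≤ s := by rw [hs]; linarith
  set N : ℕ := S * d with hN
  set D' : ℕ := D * (2 * (S * d)) with hD'
  -- the substituted polynomial against the measure
  have hMfree := columns_free hy hγ0 hγ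
  have hA0 : subst M P ≠ 0 := subst_ne_zero M hMfree hP
  have hAdeg : (subst M P).totalDegree ≤ D' := totalDegree_subst_le M P
  have hAcoeff : ∀ b, |(subst M P).coeff b| ≤ (H : ℤ) := abs_coeff_subst_le M hMfree P hcoeffP
  have hlow := hmeas (subst M P) D' H hA0 hAdeg hAcoeff
  have hval : MvPolynomial.aeval (fun i => cexp (ω i)) (subst M P) =
      cexp ((N : ℂ) * ∑ i, ω i) * expPoly y P γ := aeval_subst M P hγ
  -- the approximant lies in the Lipschitz ball
  have hsm_split : s ^ m = s ^ m₀ * s ^ (D + 1) := by rw [hm, pow_add]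
  have hsD1 : (1 : ℝ) ≤ s ^ (D + 1) := one_le_pow₀ hs1
  have h2m₀ : (2 : ℝ) ^ m₀ ≤ s ^ m₀ := pow_le_pow_left₀ (by norm_num) hs2 m₀
  have hsm_ge : (c₆ + δ⁻¹ + 1) * s ^ (D + 1) ≤ s ^ m := by
    rw [hsm_split]
    exact mul_le_mul_of_nonneg_right (hm₀.trans h2m₀) (by positivity)
  have hsm_gt_inv : δ⁻¹ < s ^ m := by
    have h1 : δ⁻¹ + 1 ≤ (c₆ + δ⁻¹ + 1) * s ^ (D + 1) := by
      calc δ⁻¹ + 1 = (δ⁻¹ + 1) * 1 := (mul_one _).symm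
        _ ≤ (c₆ + δ⁻¹ + 1) * s ^ (D + 1) := by gcongr; linarith
    linarith
  have hsm_pos : 0 < s ^ m := by positivity
  have hγξ : ‖γ - ξ‖ < Real.exp (-Real.exp (s ^ m)) := by
    rw [norm_sub_rev]; exact hdist
  have hεδ : Real.exp (-Real.exp (s ^ m)) < δ := by
    have h1 : Real.exp (-Real.exp (s ^ m)) ≤ Real.exp (-(s ^ m)) :=
      Real.exp_le_exp.mpr (neg_le_neg (self_le_exp _))
    have h2 : Real.exp (-(s ^ m)) ≤ 1 / s ^ m := exp_neg_le_one_div hsm_pos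
    have h3 : 1 / s ^ m < δ := by
      rw [div_lt_iff₀ hsm_pos]
      have : δ * δ⁻¹ < δ * s ^ m := mul_lt_mul_of_pos_left hsm_gt_inv hδ
      rwa [mul_inv_cancel₀ hδ.ne'] at this
    linarith
  have hLipγ := hLip γ (hγξ.trans hεδ)
  -- upper bound of the value
  have hexpN : ‖cexp ((N : ℂ) * ∑ i, ω i)‖ ≤ Real.exp ((N : ℝ) * w) := by
    rw [Complex.norm_exp]
    refine Real.exp_le_exp.mpr ?_
    have h1 : ((N : ℂ) * ∑ i, ω i).re = (N : ℝ) * (∑ i, ω i).re := by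
      rw [show (N : ℂ) = ((N : ℝ) : ℂ) by norm_cast, Complex.re_ofReal_mul]
    rw [h1]
    exact mul_le_mul_of_nonneg_left (Complex.re_le_norm _) (Nat.cast_nonneg _)
  have hup : ‖MvPolynomial.aeval (fun i => cexp (ω i)) (subst M P)‖ ≤
      Real.exp ((N : ℝ) * w) * (K * Real.exp (-Real.exp (s ^ m))) := by
    rw [hval, norm_mul]
    refine mul_le_mul hexpN (hLipγ.trans ?_) (norm_nonneg _) (Real.exp_pos _).le
    exact mul_le_mul_of_nonneg_left hγξ.le hK0
  -- the clash, in exponent form: exp(s^m) ≤ K + N w + Λ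
  set Λ : ℝ := c₂ * (D' : ℝ) ^ D *
      (Real.log H + Real.exp (C * (D' : ℝ) ^ D * Real.log ((D' : ℝ) + 1))) with hΛ
  have hchain : Real.exp (-Λ) ≤ Real.exp ((N : ℝ) * w) * (K * Real.exp (-Real.exp (s ^ m))) :=
    hlow.trans hup
  have hX : Real.exp (s ^ m) ≤ K + (N : ℝ) * w + Λ := by
    -- exp(-Λ) ≤ exp(Nw) K exp(-X)  ⟹  exp(X) ≤ K exp(Nw + Λ) ≤ exp(K + Nw + Λ)
    have h1 : Real.exp (Real.exp (s ^ m)) * Real.exp (-Λ) ≤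
        Real.exp (Real.exp (s ^ m)) * (Real.exp ((N : ℝ) * w) * (K * Real.exp (-Real.exp (s ^ m)))) :=
      mul_le_mul_of_nonneg_left hchain (Real.exp_pos _).le
    have h2 : Real.exp (Real.exp (s ^ m)) * (Real.exp ((N : ℝ) * w) * (K * Real.exp (-Real.exp (s ^ m)))) =
        K * Real.exp ((N : ℝ) * w) := by
      have : Real.exp (Real.exp (s ^ m)) * Real.exp (-Real.exp (s ^ m)) = 1 := by
        rw [← Real.exp_add, add_neg_cancel, Real.exp_zero]
      calc Real.exp (Real.exp (s ^ m)) * (Real.exp ((N : ℝ) * w) * (K * Real.exp (-Real.exp (s ^ m))))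
          = (Real.exp (Real.exp (s ^ m)) * Real.exp (-Real.exp (s ^ m))) * (K * Real.exp ((N : ℝ) * w)) := by ring
        _ = K * Real.exp ((N : ℝ) * w) := by rw [this, one_mul]
    rw [h2] at h1
    have h3 : Real.exp (Real.exp (s ^ m) - Λ) ≤ Real.exp (K + (N : ℝ) * w) := by
      rw [Real.exp_sub, div_le_iff₀ (Real.exp_pos Λ)]
      calc Real.exp (Real.exp (s ^ m)) = Real.exp (Real.exp (s ^ m)) * Real.exp (-Λ) * Real.exp Λ := by
            rw [mul_assoc, ← Real.exp_add, neg_add_cancel, Real.exp_zero, mul_one]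
        _ ≤ K * Real.exp ((N : ℝ) * w) * Real.exp Λ := by gcongr
        _ ≤ Real.exp K * Real.exp ((N : ℝ) * w) * Real.exp Λ := by gcongr; exact self_le_exp K
        _ = Real.exp (K + (N : ℝ) * w) * Real.exp Λ := by rw [Real.exp_add]
    have h4 := Real.exp_le_exp.mp h3
    linarith
  -- sizes in terms of u = q · s
  set u : ℝ := (q : ℝ) * s with hu
  have hq1 : (1 : ℝ) ≤ q := by rw [hq]; exact_mod_cast Nat.succ_le_succ (Nat.zero_le _)
  have hu1 : 1 ≤ u := by rw [hu]; nlinarith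
  have hu0 : 0 < u := by linarith
  have hdq : (d : ℝ) ≤ q := by rw [hq]; exact_mod_cast (by omega : d ≤ 2 * D * d + d + 1)
  have hNu : (N : ℝ) ≤ u := by
    rw [hN, hu]; push_cast
    calc (S : ℝ) * d = d * S := mul_comm _ _
      _ ≤ q * s := mul_le_mul hdq hSs hS0 (by linarith)
  have hD'u : (D' : ℝ) + 1 ≤ u := by
    rw [hD', hu, hq]; push_cast
    have h1 : (D : ℝ) * (2 * ((S : ℝ) * d)) = (2 * D * d) * S := by ring
    rw [h1]
    have hDd : (0 : ℝ) ≤ 2 * D * d := by positivity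
    nlinarith
  have hD'u' : (D' : ℝ) ≤ u := by linarith
  have hD'0 : (0 : ℝ) ≤ D' := Nat.cast_nonneg _
  have hD'pow : (D' : ℝ) ^ D ≤ u ^ D := pow_le_pow_left₀ hD'0 hD'u' D
  have huD : u ^ D ≤ u ^ (D + 1) := pow_le_pow_right₀ hu1 (Nat.le_succ D)
  have huD1 : 1 ≤ u ^ (D + 1) := one_le_pow₀ hu1
  have hu_le : u ≤ u ^ (D + 1) := by
    calc u = u ^ 1 := (pow_one u).symm
      _ ≤ u ^ (D + 1) := pow_le_pow_right₀ hu1 (by omega)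
  have hlogH : Real.log H ≤ H := (Real.log_le_sub_one_of_pos hHpos).trans (by linarith)
  have hlogH0 : 0 ≤ Real.log H := Real.log_nonneg hH1
  have hlogD' : Real.log ((D' : ℝ) + 1) ≤ u :=
    ((Real.log_le_sub_one_of_pos (by positivity)).trans (by linarith)).trans hD'u
  have hlogD'0 : 0 ≤ Real.log ((D' : ℝ) + 1) := Real.log_nonneg (by linarith)
  -- Λ ≤ c₂ u^{D+1} H + c₂ u^{D+1} exp(C u^{D+1})
  have hinner : C * (D' : ℝ) ^ D * Real.log ((D' : ℝ) + 1) ≤ C * u ^ (D + 1) := by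
    calc C * (D' : ℝ) ^ D * Real.log ((D' : ℝ) + 1) ≤ C * u ^ D * u := by
          gcongr
      _ = C * u ^ (D + 1) := by rw [pow_succ]; ring
  have hΛle : Λ ≤ c₂ * u ^ (D + 1) * H + c₂ * u ^ (D + 1) * Real.exp (C * u ^ (D + 1)) := by
    rw [hΛ]
    calc c₂ * (D' : ℝ) ^ D * (Real.log H + Real.exp (C * (D' : ℝ) ^ D * Real.log ((D' : ℝ) + 1)))
        ≤ c₂ * u ^ (D + 1) * ((H : ℝ) + Real.exp (C * u ^ (D + 1))) := by
          gcongr c₂ * ?_ * (?_ + ?_)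
          · exact hD'pow.trans huD
          · exact Real.exp_le_exp.mpr hinner
      _ = c₂ * u ^ (D + 1) * H + c₂ * u ^ (D + 1) * Real.exp (C * u ^ (D + 1)) := by ring
  have hE1 : 1 ≤ Real.exp (C * u ^ (D + 1)) := Real.one_le_exp (by positivity)
  have htot : K + (N : ℝ) * w + Λ ≤ G * u ^ (D + 1) * Real.exp (C * u ^ (D + 1)) := by
    have h1 : K ≤ K * u ^ (D + 1) * Real.exp (C * u ^ (D + 1)) := by
      calc K = K * 1 * 1 := by ring
        _ ≤ K * u ^ (D + 1) * Real.exp (C * u ^ (D + 1)) := by gcongr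
    have h2 : (N : ℝ) * w ≤ w * u ^ (D + 1) * Real.exp (C * u ^ (D + 1)) := by
      calc (N : ℝ) * w ≤ u * w := mul_le_mul_of_nonneg_right hNu hw0
        _ = w * u * 1 := by ring
        _ ≤ w * u ^ (D + 1) * Real.exp (C * u ^ (D + 1)) := by gcongr
    have h3 : c₂ * u ^ (D + 1) * H ≤ c₂ * H * u ^ (D + 1) * Real.exp (C * u ^ (D + 1)) := by
      calc c₂ * u ^ (D + 1) * H = c₂ * H * u ^ (D + 1) * 1 := by ring
        _ ≤ c₂ * H * u ^ (D + 1) * Real.exp (C * u ^ (D + 1)) := by gcongr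
    have h4 : G * u ^ (D + 1) * Real.exp (C * u ^ (D + 1)) =
        K * u ^ (D + 1) * Real.exp (C * u ^ (D + 1)) + w * u ^ (D + 1) * Real.exp (C * u ^ (D + 1)) +
        c₂ * H * u ^ (D + 1) * Real.exp (C * u ^ (D + 1)) +
        c₂ * u ^ (D + 1) * Real.exp (C * u ^ (D + 1)) := by rw [hG]; ring
    rw [h4]; linarith
  have htot2 : G * u ^ (D + 1) * Real.exp (C * u ^ (D + 1)) ≤ Real.exp (c₆ * s ^ (D + 1)) := by
    have h1 : G * u ^ (D + 1) ≤ Real.exp (G * u ^ (D + 1)) := self_le_exp _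
    have h2 : (G + C) * u ^ (D + 1) = c₆ * s ^ (D + 1) := by
      rw [hc₆, hu, mul_pow]; ring
    calc G * u ^ (D + 1) * Real.exp (C * u ^ (D + 1))
        ≤ Real.exp (G * u ^ (D + 1)) * Real.exp (C * u ^ (D + 1)) := by gcongr
      _ = Real.exp (c₆ * s ^ (D + 1)) := by rw [← Real.exp_add, ← h2]; ring_nf
  -- but s^m > c₆ s^{D+1}
  have hfinal : c₆ * s ^ (D + 1) < s ^ m := by
    have h1 : c₆ * s ^ (D + 1) < (c₆ + δ⁻¹ + 1) * s ^ (D + 1) := by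
      apply mul_lt_mul_of_pos_right _ (by positivity)
      linarith
    exact h1.trans_le hsm_ge
  have hlt : Real.exp (c₆ * s ^ (D + 1)) < Real.exp (s ^ m) := Real.exp_lt_exp.mpr hfinal
  linarith

/-- **THE SCALE-TRANSFER THEOREM.** For `y` ℚ-free and a scale `ξ` hyper-approximable through the order
lattice of an algebraic ℚ-free `ω`, the exponentials `e^{ξ y₁}, …, e^{ξ yₙ}` are algebraically
independent over `ℚ` (mod `hLW`). -/
theorem algebraicIndependent_exp_scale (hLW : LWMeasure) {ω : Fin D → ℂ}
    (hωalg : ∀ i, IsAlgebraic ℚ (ω i)) (hω : LinearIndependent ℚ ω) {y : Fin n → ℂ}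
    (hy : LinearIndependent ℚ y) {ξ : ℂ} (hξ : HyperScaleApprox ω y ξ) :
    AlgebraicIndependent ℚ (fun j => cexp (ξ * y j)) := by
  rw [algebraicIndependent_iff]
  intro g hg
  obtain ⟨Nz, G, hNz, hG⟩ := exists_int_mul_eq_map g
  by_contra hg0
  have hG0 : G ≠ 0 := by
    intro h0
    rw [h0, map_zero, eq_comm, mul_eq_zero] at hG
    rcases hG with h | h
    · exact hNz (by exact_mod_cast (MvPolynomial.C_eq_zero.mp h))
    · exact hg0 h
  have hval : expPoly y G ξ = 0 := by
    unfold expPoly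
    rw [← mvaeval_int_map _ G, hG, map_mul, hg, mul_zero]
  exact expPoly_ne_zero_of_hyperScaleApprox hLW hωalg hω hy hξ hG0 hval

/-- **Schanuel's bound on the cell**: `trdeg ℚ(ξy, e^{ξy}) ≥ n` (indeed the `n` exponentials alone are
algebraically independent) — `S` itself, not only `S⁻`, at every length `n`. -/
theorem sb_scale (hLW : LWMeasure) {ω : Fin D → ℂ}
    (hωalg : ∀ i, IsAlgebraic ℚ (ω i)) (hω : LinearIndependent ℚ ω) {y : Fin n → ℂ}
    (hy : LinearIndependent ℚ y) {ξ : ℂ} (hξ : HyperScaleApprox ω y ξ) :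
    SB n (fun j => ξ * y j) :=
  sb_of_algebraicIndependent (algebraicIndependent_exp_scale hLW hωalg hω hy hξ) (by simp)
    fun j => mem_adjoin_SFset_I' (Or.inr ⟨j, rfl⟩)

end Summit.Schanuel.Schanuel.Theorems.RootDecomp1EScaleTransfer

end
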